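import Mathlib
import Summits.Ventures.DiscreteObjects.Mahler.SubLehmerDegree57

/-!
# Sub-Lehmer polynomials at degree 58: shape of a reducible one (venture `DiscreteObjects`, target L)

Cell `pub-namedobj`, seat `pub-namedobj-mahler` (gen 5). Framing: lottery ticket; floor = certified
bounds/negative ranges.

Continuation of `SubLehmerDegree56` / `SubLehmerDegree57` (all conditional on the named fact
`SubLehmerDegreeBound` = [MRW08, Thm 1.1]).  At degree `58` a sub-Lehmer integer polynomial is EITHER
irreducible (then, as at degree 56, cyclotomic-free with nonzero constant term — `irreducible_scope_58`)
OR it is `C · Q` with `Q` sub-Lehmer of degree `56` or `57` and `C` an integer polynomial of degree `1`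
or `2` of Mahler measure `1` (`subLehmer_degree58_structure`); `Q` then falls under the degree-56/57
files and `C` under `linear_of_measure_one` / `quadratic_of_measure_one` (coefficient bounds
`|c₂| = 1, |c₁| ≤ 2, |c₀| ≤ 1` from Mathlib's Mignotte bound).  For the cell's census this is the
statement that degree 58 = the irreducible degree-58 slice + finitely many explicit "offset" families
over the degree-56/57 slices (EFFICIENCY-L6c §10).  Nothing here is a bound on Mahler measures; all
three theorems are elementary consequences of the named fact.
-/

namespace Summit.Ventures.DiscreteObjects.Mahler

open Polynomial Literature.NumberTheory.MahlerMeasure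

/-- Coefficient bounds for an integer polynomial of degree `2` and Mahler measure `1`:
`|c₂| = 1`, `|c₁| ≤ 2`, `|c₀| ≤ 1` (leading coefficient and Mignotte's bound `|c_k| ≤ C(2,k)·M`). -/
theorem quadratic_of_measure_one {b : ℤ[X]} (hdeg : b.natDegree = 2) (hM : intMahlerMeasure b = 1) :
    |b.coeff 2| = 1 ∧ |b.coeff 1| ≤ 2 ∧ |b.coeff 0| ≤ 1 := by
  have hb0 : b ≠ 0 := by intro h0; rw [h0, natDegree_zero] at hdeg; exact absurd hdeg (by norm_num)
  have hlc : b.leadingCoeff = b.coeff 2 := by rw [leadingCoeff, hdeg]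
  have h2 : ‖(b.map (Int.castRingHom ℂ)).leadingCoeff‖ ≤ (b.map (Int.castRingHom ℂ)).mahlerMeasure :=
    leadingCoeff_le_mahlerMeasure _
  rw [leadingCoeff_map_of_injective (Int.castRingHom ℂ).injective_int, hlc] at h2
  have h1c : ‖(b.map (Int.castRingHom ℂ)).coeff 1‖ ≤
      ((b.map (Int.castRingHom ℂ)).natDegree.choose 1 : ℝ) * (b.map (Int.castRingHom ℂ)).mahlerMeasure :=
    norm_coeff_le_choose_mul_mahlerMeasure 1 _
  have h0c : ‖(b.map (Int.castRingHom ℂ)).coeff 0‖ ≤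
      ((b.map (Int.castRingHom ℂ)).natDegree.choose 0 : ℝ) * (b.map (Int.castRingHom ℂ)).mahlerMeasure :=
    norm_coeff_le_choose_mul_mahlerMeasure 0 _
  rw [natDegree_map_eq_of_injective (Int.castRingHom ℂ).injective_int, coeff_map] at h1c h0c
  change ‖((Int.castRingHom ℂ) (b.coeff 2))‖ ≤ intMahlerMeasure b at h2
  change ‖((Int.castRingHom ℂ) (b.coeff 1))‖ ≤ (b.natDegree.choose 1 : ℝ) * intMahlerMeasure b at h1c
  change ‖((Int.castRingHom ℂ) (b.coeff 0))‖ ≤ (b.natDegree.choose 0 : ℝ) * intMahlerMeasure b at h0c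
  rw [hM] at h2 h1c h0c
  rw [hdeg] at h1c h0c
  simp only [eq_intCast, Complex.norm_intCast, Nat.choose_zero_right, Nat.cast_one,
    mul_one] at h2 h1c h0c
  have hl0 : b.coeff 2 ≠ 0 := by rw [← hlc]; exact leadingCoeff_ne_zero.mpr hb0
  have hl1 : (1 : ℤ) ≤ |b.coeff 2| := Int.one_le_abs hl0
  refine ⟨?_, ?_, ?_⟩
  · have : (|b.coeff 2| : ℝ) ≤ 1 := by exact_mod_cast h2
    have : |b.coeff 2| ≤ 1 := by exact_mod_cast this
    omega
  · have h21 : (Nat.choose 2 1 : ℝ) = 2 := by norm_num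
    rw [h21] at h1c
    have : (|b.coeff 1| : ℝ) ≤ 2 := by exact_mod_cast h1c
    exact_mod_cast this
  · have : (|b.coeff 0| : ℝ) ≤ 1 := by exact_mod_cast h0c
    exact_mod_cast this

/-- The irreducible case at degree 58 (as at degree 56): an IRREDUCIBLE sub-Lehmer integer polynomial of
degree `58` has nonzero constant term and no cyclotomic factor. -/
theorem irreducible_scope_58 {P : ℤ[X]} (hdeg : P.natDegree = 58) (hP : SubLehmer P)
    (hirr : Irreducible P) : P.coeff 0 ≠ 0 ∧ ∀ n : ℕ, 0 < n → ¬ cyclotomic n ℤ ∣ P := by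
  have hP0 : P ≠ 0 := by
    intro h0; rw [h0, natDegree_zero] at hdeg; exact absurd hdeg (by norm_num)
  -- a proper factor of positive degree is impossible
  have key : ∀ {D : ℤ[X]}, D ∣ P → 0 < D.natDegree → D.natDegree < 58 → False := by
    intro D hD hDpos hDlt
    obtain ⟨R, hR⟩ := hD
    rcases hirr.isUnit_or_isUnit hR with hu | hu
    · have := natDegree_eq_zero_of_isUnit hu; omega
    · have h0 := natDegree_eq_zero_of_isUnit hu
      have hD0 : D ≠ 0 := by rintro rfl; rw [zero_mul] at hR; exact hP0 hR
      have hR0 : R ≠ 0 := by rintro rfl; rw [mul_zero] at hR; exact hP0 hR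
      have : P.natDegree = D.natDegree := by rw [hR, natDegree_mul hD0 hR0, h0, add_zero]
      omega
  refine ⟨fun h0 => key (X_dvd_iff.mpr h0) (by rw [natDegree_X]; norm_num) (by rw [natDegree_X]; norm_num),
    fun n hn hdvd => ?_⟩
  have hφ : (cyclotomic n ℤ).natDegree = Nat.totient n := natDegree_cyclotomic n ℤ
  have hpos : 0 < (cyclotomic n ℤ).natDegree := by rw [hφ]; exact Nat.totient_pos.mpr hn
  by_cases hlt : (cyclotomic n ℤ).natDegree < 58
  · exact key hdvd hpos hlt
  · -- a cyclotomic factor of degree ≥ 58 would be (up to a unit) all of P, forcing M(P) = 1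
    obtain ⟨R, hR⟩ := hdvd
    have hc0 : cyclotomic n ℤ ≠ 0 := cyclotomic_ne_zero n ℤ
    have hR0 : R ≠ 0 := by rintro rfl; rw [mul_zero] at hR; exact hP0 hR
    have hdegs : P.natDegree = (cyclotomic n ℤ).natDegree + R.natDegree := by rw [hR, natDegree_mul hc0 hR0]
    have hRd : R.natDegree = 0 := by omega
    have hMR : intMahlerMeasure R = |((R.coeff 0 : ℤ) : ℝ)| := by
      conv_lhs => rw [eq_C_of_natDegree_eq_zero hRd]
      exact intMahlerMeasure_C _
    have hM : intMahlerMeasure P = |((R.coeff 0 : ℤ) : ℝ)| := by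
      rw [hR, intMahlerMeasure_mul, intMahlerMeasure_cyclotomic, one_mul, hMR]
    -- |R.coeff 0| is an integer in (1, 1.18): impossible
    have hRc0 : R.coeff 0 ≠ 0 := by
      intro h0; apply hR0; rw [eq_C_of_natDegree_eq_zero hRd, h0, C_0]
    have h1 : (1 : ℤ) ≤ |R.coeff 0| := Int.one_le_abs hRc0
    have hlt1 : (1 : ℝ) < |((R.coeff 0 : ℤ) : ℝ)| := by rw [← hM]; exact hP.1
    have hlt2 : |((R.coeff 0 : ℤ) : ℝ)| < 2 := by
      have hLup : intMahlerMeasure lehmerPoly < 117629 / 100000 := lehmer_measure_upper_bound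
      have := hP.2; rw [hM] at this; linarith
    have h1' : (1 : ℤ) < |R.coeff 0| := by
      have : ((1 : ℤ) : ℝ) < (|R.coeff 0| : ℝ) := by simpa [Int.cast_abs] using hlt1
      exact_mod_cast this
    have h2' : |R.coeff 0| < 2 := by
      have : (|R.coeff 0| : ℝ) < 2 := by simpa [Int.cast_abs] using hlt2
      exact_mod_cast this
    omega

/-- **Degree 58: the reducible case** (kernel; conditional on [MRW08, Thm 1.1]): a sub-Lehmer integer
polynomial of degree `58` is either irreducible, or of the form `C · Q` with `Q` sub-Lehmer of degree
`56` or `57` and `C` of degree `1` or `2` and Mahler measure `1`.  (`Q` is then governed by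
`SubLehmerDegree56` / `subLehmer_degree57_structure`, `C` by `linear_of_measure_one` /
`quadratic_of_measure_one`.) -/
theorem subLehmer_degree58_structure (h : SubLehmerDegreeBound) {P : ℤ[X]} (hdeg : P.natDegree = 58)
    (hP : SubLehmer P) :
    Irreducible P ∨ ∃ C Q : ℤ[X], P = C * Q ∧ SubLehmer Q ∧ intMahlerMeasure C = 1 ∧
      1 ≤ C.natDegree ∧ C.natDegree ≤ 2 ∧ Q.natDegree + C.natDegree = 58 := by
  by_cases hirr : Irreducible P
  · exact Or.inl hirr
  right
  have hP0 : P ≠ 0 := by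
    intro h0; rw [h0, natDegree_zero] at hdeg; exact absurd hdeg (by norm_num)
  have hnu : ¬ IsUnit P := fun hu => by have := natDegree_eq_zero_of_isUnit hu; omega
  obtain ⟨a, b, hab, hna, hnb⟩ : ∃ a b : ℤ[X], P = a * b ∧ ¬ IsUnit a ∧ ¬ IsUnit b := by
    by_contra hnone
    push Not at hnone
    exact hirr ⟨hnu, fun a b hab => by
      by_cases ha : IsUnit a
      · exact Or.inl ha
      · exact Or.inr (hnone a b hab ha)⟩
  have ha0 : a ≠ 0 := by intro h0; apply hP0; rw [hab, h0, zero_mul]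
  have hb0 : b ≠ 0 := by intro h0; apply hP0; rw [hab, h0, mul_zero]
  -- arrange that b is the measure-1 factor
  wlog hMb : intMahlerMeasure b = 1 generalizing a b
  · have hor := measure_one_of_mul h hP hab (by omega)
    have hMa : intMahlerMeasure a = 1 := by tauto
    exact this b a (by rw [hab, mul_comm]) hnb hna hb0 ha0 hMa
  have hbdeg : b.natDegree + 56 ≤ P.natDegree :=
    natDegree_le_of_dvd_of_measure_one h hP (Dvd.intro_left a hab.symm) hMb
  have hbd2 : b.natDegree ≤ 2 := by omega
  have hbd1 : 1 ≤ b.natDegree := by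
    by_contra hlt
    have h0 : b.natDegree = 0 := by omega
    rw [eq_C_of_natDegree_eq_zero h0] at hMb hnb
    rw [intMahlerMeasure_C] at hMb
    apply hnb
    apply isUnit_C.mpr
    rw [Int.isUnit_iff_abs_eq]
    exact_mod_cast hMb
  have hsum : a.natDegree + b.natDegree = 58 := by rw [← hdeg, hab, natDegree_mul ha0 hb0]
  have hMa : intMahlerMeasure a = intMahlerMeasure P := by
    rw [hab, intMahlerMeasure_mul, hMb, mul_one]
  refine ⟨b, a, by rw [hab, mul_comm], ?_, hMb, hbd1, hbd2, hsum⟩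
  unfold SubLehmer at hP ⊢
  rw [hMa]; exact hP

end Summit.Ventures.DiscreteObjects.Mahler
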